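import Literature.MathematicalPhysics.QuantumFieldTheory.Balaban1983to89.B9CubeLettersOpsL0
import Literature.MathematicalPhysics.QuantumFieldTheory.Balaban1983to89.B9CubeV1Data
import Literature.MathematicalPhysics.QuantumFieldTheory.Balaban1983to89.B6GlobalChartV1L0

/-!
# `Balaban1983to89.B9CubeBondWeights` — V1 INDEX DATA OF THE CUBE SEQUENCE `{Ω_n(□)}` OF [B9] SECT. C, PART 2: THE BOND-DOMAIN STRUCTURE
# `domCube` AND THE BOND WEIGHTS `w_□` IN THE GLOBAL BAND, EQUAL TO THE MEMBER'S ON THE MEMBER'S INDEX BONDS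
# (prerequisite (P2) of the bond sector `G_□(U)`, `C_□(U)` — lead g29 RULING #5; sub-row G-B9-LETTERS, module M5.1c part 2)

FRAMING (verbatim cell line):
statement-level skeleton of published theorems with citation tags; proofs where landed; nothing here is a claim about the Yang–Mills mass gap

Sources under audit (cell lit-balaban): T. Bałaban, *Propagators for lattice gauge theories in a background field*, Commun. Math. Phys. **99**
(1985) 389–434 [`Balaban1985BackgroundPropagators`, "B9"], Sect. C pp. 408–409, (3.7) p. 391; T. Bałaban, *Propagators and renormalization
transformations for lattice gauge theories. II*, Commun. Math. Phys. **96** (1984) 223–250 [`Balaban1984PropagatorsII`, "[4]"], (2.3) p. 224,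
(2.16) p. 225, (2.90) p. 239.  Unit `lit-balaban-r05` (r05 gen 77).

## WHAT IS PRINTED (verbatim up to notation)

[B9] p. 408–409: «consider the sequence □^{2(k−j)+3} ⊃ … ⊃ □³ ∩ B^{j+1}(Λ_{j+1}) instead of {Ω_j} … The operators constructed for this sequence …
G_□(U), satisfy all the inequalities of Theorems 3.1–3.3»; (3.7) p. 391: «Δ_a(U) = D*_U D_U + Q*(U)aQ(U), a| _{Λ_j} = a_j(L^jη)^{−2}»; [4] (2.3)
p. 224: «Λ_j = Ω_j ∖ Ω_{j+1} … also the set of bonds»; (2.16) p. 225 the weights `a_j`.  The cube operators are «constructed for this sequence»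
by the same formulas — in particular with the SAME bond weights on the bonds where the two sequences have the same level.

## WHAT THIS FILE CERTIFIES (kernel-checked; def-Y index `i : KIdx`, member `D = i.D`, cube family `F = cubeFamY i q`)

* `domCube i q := B6GlobalChartV1L0.domT i.hN (cubeFamY i q) i.hk` — the V1 bond-domain structure (2.3) of the cube sequence on ROUTE V's
  periodic box (same `k`, same fine lattice as the member's `domT i.hN i.D i.hk`; its index bonds `BondIdx (domCube i q)` are pairs
  (level, coarse bond) exactly as the member's, with the cube sequence's membership predicate);
* `bandLow b₀ cf j := b₀·(L^j)^{d+1}·(cf/L^j)²` — the lower edge of the global band (2.16)/(2.90) at level `j`;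
* ★ `wCubeBond i q : BondIdx (domCube i q) → ℝ` — THE BOND WEIGHTS OF THE CUBE SEQUENCE: the member's weight `i.w` on every index bond that is
  also an index bond of the member (same level, same coarse bond), the band's lower edge elsewhere;
* `wCubeBond_eq_of_lamBond` (agreement with `i.w` on the member's index bonds), `wCubeBond_pos` (`b₀ > 0`), ★ `wCubeBond_band` :
  `GlobalBand b₀ b₁ i.cf (wCubeBond i q)` (`b₀ ≤ b₁`) — the three inputs `hcf ∕ hw ∕ GlobalBand` of the `…V1L0` lineage
  (`B6Cor28EntriesKLevelV1L0.cor28_kLevel_H`, Prop. 2.6 ∕ 2.7) for the cube family, the placement being `B9CubeV1Data.placed_cubeFam`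
  (`placed_cubeFamY`).

## HONEST SCOPE

* Data only: the bond-sector letters `Δ_{a,□}(U)`, `G_□(U) = Δ_{a,□}(U)⁻¹`, `C_□(U)` (def-Y's `Node00.OpsYDeltaA` re-instantiated, (P4)) and the
  identification «index bonds of the cube sequence near □ = index bonds of the member near □» (the bond-sector row agreement) are NOT in this
  file.  Off the member's index bonds the weight is a CHOICE within the band (print fixes `a_j` by level only; any band value serves Thm 3.3).
* Nothing is inferred from the manuscript; kernel-checked.  NOT summit progress; the YM mass gap is not proved by any of this.
-/

namespace Literature.MathematicalPhysics.QuantumFieldTheory.Balaban1983to89.B9CubeBondWeights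

open LatticeFieldCalculus
open Node00
open Literature.MathematicalPhysics.QuantumFieldTheory.Balaban1983to89.B6KLevelCensusIndexV1 (KIdx)
open Literature.MathematicalPhysics.QuantumFieldTheory.Balaban1983to89.B6SectAOperatorsV1 (BondIdx)
open Literature.MathematicalPhysics.QuantumFieldTheory.Balaban1983to89.B6GlobalChartV1 (PV domT)
open Literature.MathematicalPhysics.QuantumFieldTheory.Balaban1983to89.B6CubeWindowV1 (Placed GlobalBand)
open Literature.MathematicalPhysics.QuantumFieldTheory.Balaban1983to89.B6Cover236MultiLevelBlocks (cubes)
open Literature.MathematicalPhysics.QuantumFieldTheory.Balaban1983to89.B9CubeLettersOpsL0 (cubeFamY)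
open Literature.MathematicalPhysics.QuantumFieldTheory.Balaban1983to89.B9CubeV1Data (placed_cubeFam)

variable {d ℓ : ℕ} {hd : 1 ≤ d + 1} {hL : Odd (ℓ + 1) ∧ 1 < ℓ + 1} {b₀ b₁ : ℝ}

/-! ## §1 The bond-domain structure of the cube sequence and its placement -/

section Dom

variable (i : KIdx d ℓ hd hL b₀ b₁) (q : ↥(cubes (toKT i).D.toDomains))

/-- **THE V1 BOND-DOMAIN STRUCTURE (2.3) OF THE CUBE SEQUENCE** on ROUTE V's periodic box. [cite: Balaban1985BackgroundPropagators, p.408; Balaban1984PropagatorsII, (2.3) p.224] -/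
noncomputable abbrev domCube : B6SectADomainsV1.Domains (PV d ℓ i.m i.K hd hL) := B6GlobalChartV1L0.domT i.hN (cubeFamY i q) i.hk

/-- the cube sequence has the member's number of levels `k`. [cite: Balaban1985BackgroundPropagators, p.408, bookkeeping] -/
theorem domCube_k : (domCube i q).k = i.k := rfl

/-- ★ the cover cubes of the cube sequence are placed (def-Y's `KIdx.hpl`, `KIdx.hP5`; `B9CubeV1Data.placed_cubeFam`).
[cite: Balaban1984PropagatorsII, p.229, p.238 (charts); Balaban1985BackgroundPropagators, p.409 l.1–5] -/
theorem placed_cubeFamY : ∀ c : ↥(B6Cover236MultiLevelBlocksL0.cubes (cubeFamY i q).toDomains), Placed ℓ i.k i.P' c.1 :=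
  fun c => placed_cubeFam i.hP5 i.hpl c

end Dom

/-! ## §2 The bond weights `w_□` -/

section Weights

/-- **THE LOWER EDGE OF THE GLOBAL BAND AT LEVEL `j`**: `b₀·(L^j)^{d+1}·(cf/L^j)²`. [cite: Balaban1984PropagatorsII, (2.16) p.225, (2.90) p.239] -/
noncomputable def bandLow (d ℓ : ℕ) (b₀ cf : ℝ) (j : ℕ) : ℝ :=
  b₀ * ((((ℓ + 1 : ℕ) : ℝ)) ^ j) ^ (d + 1) * (cf / (((ℓ + 1 : ℕ) : ℝ) ^ j)) ^ 2

/-- the V1 factor over the scale is non-zero. [cite: Balaban1984PropagatorsII, (2.16) p.225, bookkeeping] -/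
theorem cf_div_pow_ne_zero {cf : ℝ} (hcf : cf ≠ 0) (j : ℕ) : cf / (((ℓ + 1 : ℕ) : ℝ) ^ j) ≠ 0 :=
  div_ne_zero hcf (pow_ne_zero _ (by positivity))

/-- the lower edge is positive for `b₀ > 0`, `cf ≠ 0`. [cite: Balaban1984PropagatorsII, (2.16) p.225, bookkeeping] -/
theorem bandLow_pos {cf : ℝ} (hb₀ : 0 < b₀) (hcf : cf ≠ 0) (j : ℕ) : 0 < bandLow d ℓ b₀ cf j := by
  unfold bandLow
  have h1 : (0 : ℝ) < ((((ℓ + 1 : ℕ) : ℝ)) ^ j) ^ (d + 1) := by positivity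
  have hx := cf_div_pow_ne_zero (ℓ := ℓ) hcf j
  have h2 : (0 : ℝ) < (cf / (((ℓ + 1 : ℕ) : ℝ) ^ j)) ^ 2 := by positivity
  exact mul_pos (mul_pos hb₀ h1) h2

/-- the lower edge sits on the band's lower boundary: `bandLow/(cf/L^j)² = b₀(L^j)^{d+1}`. [cite: Balaban1984PropagatorsII, (2.16) p.225, bookkeeping] -/
theorem bandLow_div {cf : ℝ} (hcf : cf ≠ 0) (j : ℕ) :
    bandLow d ℓ b₀ cf j / (cf / (((ℓ + 1 : ℕ) : ℝ) ^ j)) ^ 2 = b₀ * ((((ℓ + 1 : ℕ) : ℝ)) ^ j) ^ (d + 1) := by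
  unfold bandLow
  rw [mul_div_assoc, div_self (pow_ne_zero _ (cf_div_pow_ne_zero (ℓ := ℓ) hcf j)), mul_one]

variable (i : KIdx d ℓ hd hL b₀ b₁) (q : ↥(cubes (toKT i).D.toDomains))

/-- ★ **THE BOND WEIGHTS OF THE CUBE SEQUENCE**: the member's `i.w` on the member's index bonds, the band's lower edge elsewhere.
[cite: Balaban1985BackgroundPropagators, p.409 l.1–5 («constructed for this sequence»), (3.7) p.391; Balaban1984PropagatorsII, (2.16) p.225] -/
noncomputable def wCubeBond : BondIdx (domCube i q) → ℝ := fun p =>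
  if h : (domT i.hN i.D i.hk).LamBond (p.1.1 : ℕ) p.1.2 then i.w ⟨p.1, h⟩ else bandLow d ℓ b₀ i.cf (p.1.1 : ℕ)

/-- **AGREEMENT WITH THE MEMBER'S WEIGHTS** on the member's index bonds. [cite: Balaban1985BackgroundPropagators, p.409 l.1–5, (3.7) p.391] -/
theorem wCubeBond_eq_of_lamBond (p : BondIdx (domCube i q)) (h : (domT i.hN i.D i.hk).LamBond (p.1.1 : ℕ) p.1.2) :
    wCubeBond i q p = i.w ⟨p.1, h⟩ := by
  unfold wCubeBond; rw [dif_pos h]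

/-- off the member's index bonds the weight is the band's lower edge. [cite: Balaban1984PropagatorsII, (2.16) p.225, bookkeeping] -/
theorem wCubeBond_eq_of_not_lamBond (p : BondIdx (domCube i q)) (h : ¬ (domT i.hN i.D i.hk).LamBond (p.1.1 : ℕ) p.1.2) :
    wCubeBond i q p = bandLow d ℓ b₀ i.cf (p.1.1 : ℕ) := by
  unfold wCubeBond; rw [dif_neg h]

/-- the weights are positive (`b₀ > 0`; the member's are by `KIdx.hw`). [cite: Balaban1984PropagatorsII, (2.16) p.225, bookkeeping] -/
theorem wCubeBond_pos (hb₀ : 0 < b₀) : ∀ p : BondIdx (domCube i q), 0 < wCubeBond i q p := by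
  intro p
  by_cases h : (domT i.hN i.D i.hk).LamBond (p.1.1 : ℕ) p.1.2
  · rw [wCubeBond_eq_of_lamBond i q p h]; exact i.hw _
  · rw [wCubeBond_eq_of_not_lamBond i q p h]; exact bandLow_pos hb₀ i.hcf _

/-- ★ **THE WEIGHTS LIE IN THE GLOBAL BAND** `[b₀, b₁]` (`b₀ ≤ b₁`; the member's do by `KIdx.hwb`). [cite: Balaban1984PropagatorsII, (2.16) p.225, (2.90) p.239] -/
theorem wCubeBond_band (hb₁ : b₀ ≤ b₁) : GlobalBand b₀ b₁ i.cf (wCubeBond i q) := by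
  intro p
  by_cases h : (domT i.hN i.D i.hk).LamBond (p.1.1 : ℕ) p.1.2
  · rw [wCubeBond_eq_of_lamBond i q p h]; exact i.hwb ⟨p.1, h⟩
  · rw [wCubeBond_eq_of_not_lamBond i q p h, bandLow_div i.hcf]
    exact ⟨le_rfl, mul_le_mul_of_nonneg_right hb₁ (by positivity)⟩

end Weights

end Literature.MathematicalPhysics.QuantumFieldTheory.Balaban1983to89.B9CubeBondWeights
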